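import Literature.Computability.AlgebraicComplexity.ConstituentStageCompatCount
import Literature.Computability.AlgebraicComplexity.MultiTypeClassCount
import Literature.Computability.AlgebraicComplexity.GlobalStageCompatProduct
import Literature.Computability.AlgebraicComplexity.MaxEntropyGivenMarginals
import HarnessLib

/-!
# The counts of the constituent stage as multi-class type classes: `numxblock`, `numalpha`, `M_Z`
(Vassilevska Williams–Xu–Xu–Zhou 2024, §6.2 and §6.5–§6.6) — proved

Topic `Literature/Computability/AlgebraicComplexity`.  §6.2 of Vassilevska Williams–Xu–Xu–Zhou,
*New bounds for matrix multiplication: from alpha to omega* (SODA 2024, arXiv:2307.07970):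
"`numxblock = 2^{∑_t H(γ̃_{X,t}) · A_{t,1} n_t ± o(n)}` … Let `numalpha` be the number of remaining
block triples that are consistent with `{α_t}`.  We have `numalpha = 2^{∑_t H(α_t) · A_{t,1} n_t ± o(n)}`",
and (§6.6, Claim 6.13's proof; Cor. 4.2) the number `M_Z` of level-1 `Z`-blocks of `𝒯*`.  For the data
`D : ConstituentRegion c n s M` of one region this file PROVES the exact identifications behind these
estimates, reducing each count to a multi-class type class (`MultiTypeClassCount.lean`, Lemma 3.3) or to
an exact block count (`InterfaceBlockCounts.lean`):

* `card_pairTypeClass_eq` — **`numxblock = |multiTypeClass τ k_X|`** (pair sequences), hence the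
  two-sided entropy bounds `2^{∑_t n_t H(k_X t / n_t)} / poly ≤ numxblock ≤ 2^{∑_t n_t H(k_X t / n_t)}`;
* `leftWord`, `card_consistent_eq` — **`numalpha = |multiTypeClass τ (left split-type counts)|`**: an
  `{α_t}`-consistent triple inside the level-`ℓ` blocks is determined by its word of left split types,
  and every word with the counts `cnt` comes from one (`ofLeftWord`); hence the two-sided bounds
  `2^{∑_t n_t H(α_t)} / poly ≤ numalpha ≤ 2^{∑_t n_t H(α_t)}` (`α_t = cnt t / n_t`);
* `usefulZCount_eq_card_levelBlocksZ`, `two_rpow_le_mul_usefulZCount` (and the `X`, `Y` block counts of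
  `𝒯*`) — **`M_Z(T) = |levelBlocksZ(𝒯*_T)|` = a product of multinomials, `≥ 2^{∑ |S_{t,i',j',k'}| H(β_{Z,t,i',j',k'})} / poly`**
  for integral class types.

Everything is proved; the definitions are `leftWord`, `ofLeftWord`; no named facts.

## References

* V. Vassilevska Williams, Y. Xu, Z. Xu, R. Zhou, *New bounds for matrix multiplication: from alpha
  to omega*, SODA 2024, arXiv:2307.07970 (held: `paper:arxiv-2307.07970`), §6.2 (numxblock,
  numalpha), §6.5–§6.6 (𝒯*, M_Z), Lemma 3.3. [VassilevskaWilliamsXuXuZhou2024]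
-/

noncomputable section

open scoped BigOperators
open Finset

namespace Literature.Computability.AlgebraicComplexity

namespace ConstituentRegion

open scoped Classical

variable {c n s M : ℕ} {D : ConstituentRegion c n s M}

/-! ## `numxblock` -/

/-- **`numxblock = |multiTypeClass τ k_X|`**: the remaining blocks correspond to their pair sequences.
[cite: VassilevskaWilliamsXuXuZhou2024, §6.2 (numxblock)] -/
theorem card_pairTypeClass_eq {α : Type*} [Fintype α] [DecidableEq α] (τ : Fin n → Fin s) (k : Fin s → α × α → ℕ) :
    (pairTypeClass τ k).card = (multiTypeClass τ k).card := by
  refine card_nbij' halfPairs ofHalfPairs (fun I hI => ?_) (fun w hw => ?_) (fun I _ => ofHalfPairs_halfPairs I)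
    (fun w _ => halfPairs_ofHalfPairs w)
  · exact mem_coe.2 ((mem_pairTypeClass τ).1 (mem_coe.1 hI))
  · refine mem_coe.2 ((mem_pairTypeClass τ).2 ?_)
    rw [halfPairs_ofHalfPairs]; exact mem_coe.1 hw

/-- **`numxblock ≤ 2^{∑_t n_t · H(k_X t / n_t)}`** (Lemma 3.3). [cite: VassilevskaWilliamsXuXuZhou2024, §6.2 ("numxblock = 2^{∑_t H(γ̃_{X,t}) A_{t,1} n_t ± o(n)}")] -/
theorem card_pairTypeClass_le_two_rpow {α : Type*} [Fintype α] [DecidableEq α] (τ : Fin n → Fin s) (k : Fin s → α × α → ℕ)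
    (hk : ∀ t, ∑ a, k t a = Fintype.card {u // τ u = t}) :
    ((pairTypeClass τ k).card : ℝ) ≤ 2 ^ (∑ t, (Fintype.card {u // τ u = t} : ℝ) * shannonEntropy fun a => (k t a : ℝ) / Fintype.card {u // τ u = t}) := by
  rw [card_pairTypeClass_eq]
  exact card_multiTypeClass_le_two_rpow τ k hk

/-- **`2^{∑_t n_t · H(k_X t / n_t)} ≤ (∏_t (n_t+1)^{|α|²}) · numxblock`** (Lemma 3.3). [cite: VassilevskaWilliamsXuXuZhou2024, §6.2] -/
theorem two_rpow_le_mul_card_pairTypeClass {α : Type*} [Fintype α] [DecidableEq α] (τ : Fin n → Fin s) (k : Fin s → α × α → ℕ)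
    (hk : ∀ t, ∑ a, k t a = Fintype.card {u // τ u = t}) :
    (2 : ℝ) ^ (∑ t, (Fintype.card {u // τ u = t} : ℝ) * shannonEntropy fun a => (k t a : ℝ) / Fintype.card {u // τ u = t}) ≤
      (∏ t, ((Fintype.card {u // τ u = t} : ℝ) + 1) ^ Fintype.card (α × α)) * (pairTypeClass τ k).card := by
  rw [card_pairTypeClass_eq]
  exact two_rpow_le_mul_card_multiTypeClass τ k hk

/-! ## `numalpha`: consistent triples as words of left split types -/

/-- **The word of left split types** of a triple: chunk `u ↦ (I, J, K)(left u)`. [cite: VassilevskaWilliamsXuXuZhou2024, §6.2 ("block triples that are consistent with {α_t}")] -/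
def leftWord (T : (Fin (n + n) → Fin (2 * c + 1)) × (Fin (n + n) → Fin (2 * c + 1)) × (Fin (n + n) → Fin (2 * c + 1))) :
    Fin n → Fin (2 * c + 1) × Fin (2 * c + 1) × Fin (2 * c + 1) :=
  fun u => (T.1 (Fin.castAdd n u), T.2.1 (Fin.castAdd n u), T.2.2 (Fin.castAdd n u))

/-- Truncated subtraction into `Fin (2c+1)`. [folklore] -/
def finSub (c : ℕ) (m : ℕ) (a : Fin (2 * c + 1)) : Fin (2 * c + 1) :=
  ⟨min (m - a) (2 * c), by omega⟩

/-- Value of the truncated subtraction when no truncation occurs. [folklore] -/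
theorem val_finSub_of_le {m : ℕ} {a : Fin (2 * c + 1)} (h : m - a ≤ 2 * c) : (finSub c m a : ℕ) = m - a := by
  simp [finSub, h]

variable (D) in
/-- **The triple of a word of left split types** (right halves complementary in the level-`ℓ` indices).
[cite: VassilevskaWilliamsXuXuZhou2024, §6 (preamble: (l_X, i_t − l_X))] -/
def ofLeftWord (w : Fin n → Fin (2 * c + 1) × Fin (2 * c + 1) × Fin (2 * c + 1)) :
    (Fin (n + n) → Fin (2 * c + 1)) × (Fin (n + n) → Fin (2 * c + 1)) × (Fin (n + n) → Fin (2 * c + 1)) :=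
  (fun p => Fin.addCases (motive := fun _ => Fin (2 * c + 1)) (fun u => (w u).1) (fun u => finSub c (D.L (D.τ u)).i (w u).1) p,
   fun p => Fin.addCases (motive := fun _ => Fin (2 * c + 1)) (fun u => (w u).2.1) (fun u => finSub c (D.L (D.τ u)).j (w u).2.1) p,
   fun p => Fin.addCases (motive := fun _ => Fin (2 * c + 1)) (fun u => (w u).2.2) (fun u => finSub c (D.L (D.τ u)).k (w u).2.2) p)

/-- The left word of the triple of a word. [folklore] -/
@[simp] theorem leftWord_ofLeftWord (w : Fin n → Fin (2 * c + 1) × Fin (2 * c + 1) × Fin (2 * c + 1)) :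
    leftWord (D.ofLeftWord w) = w := by
  funext u
  simp [leftWord, ofLeftWord]

/-- **A triple inside the level-`ℓ` blocks is the triple of its left word.** [cite: VassilevskaWilliamsXuXuZhou2024, §6 (preamble)] -/
theorem ofLeftWord_leftWord {T : (Fin (n + n) → Fin (2 * c + 1)) × (Fin (n + n) → Fin (2 * c + 1)) × (Fin (n + n) → Fin (2 * c + 1))}
    (hI : InsideX D.τ D.L T.1) (hJ : InsideY D.τ D.L T.2.1) (hK : InsideZ D.τ D.L T.2.2) : D.ofLeftWord (leftWord T) = T := by
  refine Prod.ext ?_ (Prod.ext ?_ ?_)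
  · funext p
    refine Fin.addCases (motive := fun p => (D.ofLeftWord (leftWord T)).1 p = T.1 p) (fun u => ?_) (fun u => ?_) p
    · simp [ofLeftWord, leftWord]
    · simp only [ofLeftWord, leftWord, Fin.addCases_right]
      apply Fin.ext
      have h := hI u
      have hlt := (T.1 (Fin.natAdd n u)).isLt
      rw [val_finSub_of_le (by omega)]
      omega
  · funext p
    refine Fin.addCases (motive := fun p => (D.ofLeftWord (leftWord T)).2.1 p = T.2.1 p) (fun u => ?_) (fun u => ?_) p
    · simp [ofLeftWord, leftWord]
    · simp only [ofLeftWord, leftWord, Fin.addCases_right]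
      apply Fin.ext
      have h := hJ u
      have hlt := (T.2.1 (Fin.natAdd n u)).isLt
      rw [val_finSub_of_le (by omega)]
      omega
  · funext p
    refine Fin.addCases (motive := fun p => (D.ofLeftWord (leftWord T)).2.2 p = T.2.2 p) (fun u => ?_) (fun u => ?_) p
    · simp [ofLeftWord, leftWord]
    · simp only [ofLeftWord, leftWord, Fin.addCases_right]
      apply Fin.ext
      have h := hK u
      have hlt := (T.2.2 (Fin.natAdd n u)).isLt
      rw [val_finSub_of_le (by omega)]
      omega

/-- The left class of a triple is the fibre of its left word. [folklore] -/
theorem card_leftClass_eq_countOn (T : (Fin (n + n) → Fin (2 * c + 1)) × (Fin (n + n) → Fin (2 * c + 1)) × (Fin (n + n) → Fin (2 * c + 1)))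
    (t : Fin s) (a : Fin (2 * c + 1) × Fin (2 * c + 1) × Fin (2 * c + 1)) :
    (leftClass D.τ (seqVal T.1) (seqVal T.2.1) (seqVal T.2.2) t a.1 a.2.1 a.2.2).card = countOn (classOf D.τ t) (leftWord T) a := by
  rw [countOn_apply, filter_filter]
  congr 1
  ext u
  obtain ⟨a1, a2, a3⟩ := a
  simp only [mem_leftClass, mem_filter, mem_univ, true_and, leftWord, Prod.mk.injEq, seqVal, Fin.ext_iff]

/-- Counts of an image word are sums of counts over the fibres. [folklore] -/
theorem countOn_comp_eq_sum {α β X : Type*} [Fintype α] [DecidableEq α] [DecidableEq β] (P : Finset X) (w : X → α) (f : α → β) (b : β) :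
    countOn P (f ∘ w) b = ∑ a ∈ univ.filter (fun a => f a = b), countOn P w a := by
  rw [countOn_apply, card_eq_sum_card_fiberwise (f := w) (s := P.filter fun x => (f ∘ w) x = b) (t := univ.filter fun a => f a = b)
    (fun x hx => by simpa using (mem_filter.1 hx).2)]
  refine sum_congr rfl fun a ha => ?_
  rw [countOn_apply, filter_filter]
  congr 1; ext x
  simp only [mem_filter, Function.comp_apply, and_congr_right_iff]
  intro _
  constructor
  · rintro ⟨-, rfl⟩; rfl
  · rintro rfl; exact ⟨(mem_filter.1 ha).2, rfl⟩

/-- **The pair counts of a sequence inside the level-`ℓ` blocks are determined by its left counts**: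
`#{u ∈ term t | (I(left u), I(right u)) = (l, r)} = [r = i_t − l] · #{u ∈ term t | I(left u) = l}`.
[cite: VassilevskaWilliamsXuXuZhou2024, §6 (preamble: (l_X, i_t − l_X))] -/
theorem countOn_halfPairs_of_inside {I : Fin (n + n) → Fin (2 * c + 1)} (hI : InsideX D.τ D.L I) (t : Fin s) (l r : Fin (2 * c + 1)) :
    countOn (classOf D.τ t) (halfPairs I) (l, r) =
      if (r : ℕ) = (D.L t).i - l then ((classOf D.τ t).filter fun u => I (Fin.castAdd n u) = l).card else 0 := by
  rw [countOn_apply]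
  split_ifs with hr
  · congr 1
    refine Finset.filter_congr fun u hu => ?_
    rw [mem_classOf] at hu
    simp only [halfPairs_apply, Prod.mk.injEq]
    constructor
    · exact fun h => h.1
    · intro hl
      refine ⟨hl, Fin.ext ?_⟩
      have h := hI u
      rw [hu, hl] at h
      omega
  · rw [Finset.card_eq_zero, Finset.filter_eq_empty_iff]
    intro u hu heq
    rw [mem_classOf] at hu
    simp only [halfPairs_apply, Prod.mk.injEq] at heq
    apply hr
    have h := hI u
    rw [hu, heq.1, heq.2] at h
    omega

/-- The left counts of `I` are sums of counts of the left word. [folklore] -/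
theorem card_filter_left_eq_sum (T : (Fin (n + n) → Fin (2 * c + 1)) × (Fin (n + n) → Fin (2 * c + 1)) × (Fin (n + n) → Fin (2 * c + 1)))
    (t : Fin s) (l : Fin (2 * c + 1)) :
    ((classOf D.τ t).filter fun u => T.1 (Fin.castAdd n u) = l).card =
      ∑ a ∈ univ.filter (fun a : Fin (2 * c + 1) × Fin (2 * c + 1) × Fin (2 * c + 1) => a.1 = l), countOn (classOf D.τ t) (leftWord T) a := by
  rw [← countOn_comp_eq_sum, countOn_apply]; rfl

/-- The same for `J`. [folklore] -/
theorem card_filter_left_eq_sum₂ (T : (Fin (n + n) → Fin (2 * c + 1)) × (Fin (n + n) → Fin (2 * c + 1)) × (Fin (n + n) → Fin (2 * c + 1)))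
    (t : Fin s) (l : Fin (2 * c + 1)) :
    ((classOf D.τ t).filter fun u => T.2.1 (Fin.castAdd n u) = l).card =
      ∑ a ∈ univ.filter (fun a : Fin (2 * c + 1) × Fin (2 * c + 1) × Fin (2 * c + 1) => a.2.1 = l), countOn (classOf D.τ t) (leftWord T) a := by
  rw [← countOn_comp_eq_sum, countOn_apply]; rfl

/-- The same for `K`. [folklore] -/
theorem card_filter_left_eq_sum₃ (T : (Fin (n + n) → Fin (2 * c + 1)) × (Fin (n + n) → Fin (2 * c + 1)) × (Fin (n + n) → Fin (2 * c + 1)))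
    (t : Fin s) (l : Fin (2 * c + 1)) :
    ((classOf D.τ t).filter fun u => T.2.2 (Fin.castAdd n u) = l).card =
      ∑ a ∈ univ.filter (fun a : Fin (2 * c + 1) × Fin (2 * c + 1) × Fin (2 * c + 1) => a.2.2 = l), countOn (classOf D.τ t) (leftWord T) a := by
  rw [← countOn_comp_eq_sum, countOn_apply]; rfl

variable (D) in
/-- The counts of the left words of the consistent triples: `cnt`, read on `Fin (2c+1)³`. [cite: VassilevskaWilliamsXuXuZhou2024, §6.2] -/
abbrev leftCounts : Fin s → Fin (2 * c + 1) × Fin (2 * c + 1) × Fin (2 * c + 1) → ℕ := fun t a => D.cnt t (a.1, a.2.1, a.2.2)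

/-- **The left word of a consistent triple has the counts `cnt`.** [cite: VassilevskaWilliamsXuXuZhou2024, §6.2] -/
theorem leftWord_mem_of_consistent
    {T : (Fin (n + n) → Fin (2 * c + 1)) × (Fin (n + n) → Fin (2 * c + 1)) × (Fin (n + n) → Fin (2 * c + 1))} (hT : T ∈ D.consistent) :
    leftWord T ∈ multiTypeClass D.τ D.leftCounts := by
  obtain ⟨-, hcnt⟩ := mem_filter.1 hT
  refine mem_multiTypeClass.2 fun t a => ?_
  rw [← card_leftClass_eq_countOn]
  exact hcnt t (a.1, a.2.1, a.2.2)

/-- **`numalpha = |multiTypeClass τ cnt|`**: the `{α_t}`-consistent triples correspond bijectively, by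
their left words, to the words with the counts `cnt` on every term (given one consistent triple, through
which the pair counts `k_X, k_Y, k_Z` and the ranges of `cnt` are read off). [cite: VassilevskaWilliamsXuXuZhou2024, §6.2 ("numalpha = 2^{∑_t H(α_t) A_{t,1} n_t ± o(n)}")] -/
theorem card_consistent_eq (hD : D.WellFormed)
    {T₀ : (Fin (n + n) → Fin (2 * c + 1)) × (Fin (n + n) → Fin (2 * c + 1)) × (Fin (n + n) → Fin (2 * c + 1))} (hT₀ : T₀ ∈ D.consistent) :
    D.consistent.card = (multiTypeClass D.τ D.leftCounts).card := by
  obtain ⟨hT₀u, hcnt₀⟩ := mem_filter.1 hT₀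
  obtain ⟨hlev₀, hI₀, hJ₀, hK₀⟩ := tripleSet_good hD hT₀u
  obtain ⟨⟨hX₀, hY₀, hZ₀⟩, -⟩ := mem_tripleUniverse.1 hT₀u
  have hw₀ := leftWord_mem_of_consistent hT₀
  -- a letter of a word with the counts `cnt` occurs in `T₀` in the same term
  have hocc : ∀ {w : Fin n → Fin (2 * c + 1) × Fin (2 * c + 1) × Fin (2 * c + 1)}, w ∈ multiTypeClass D.τ D.leftCounts →
      ∀ u, ∃ u₀, D.τ u₀ = D.τ u ∧ leftWord T₀ u₀ = w u := by
    intro w hw u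
    have hpos : 0 < countOn (classOf D.τ (D.τ u)) w (w u) := by
      rw [countOn_apply]; exact card_pos.2 ⟨u, by simp⟩
    rw [(mem_multiTypeClass.1 hw) (D.τ u) (w u), ← (mem_multiTypeClass.1 hw₀) (D.τ u) (w u), countOn_apply] at hpos
    obtain ⟨u₀, hu₀⟩ := card_pos.1 hpos
    rw [mem_filter, mem_classOf] at hu₀
    exact ⟨u₀, hu₀.1, hu₀.2⟩
  -- facts about the triple of such a word
  have hgood : ∀ {w : Fin n → Fin (2 * c + 1) × Fin (2 * c + 1) × Fin (2 * c + 1)}, w ∈ multiTypeClass D.τ D.leftCounts →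
      ∀ u, ((w u).1 : ℕ) ≤ (D.L (D.τ u)).i ∧ ((w u).2.1 : ℕ) ≤ (D.L (D.τ u)).j ∧ ((w u).2.2 : ℕ) ≤ (D.L (D.τ u)).k ∧
        (D.L (D.τ u)).i - (w u).1 ≤ 2 * c ∧ (D.L (D.τ u)).j - (w u).2.1 ≤ 2 * c ∧ (D.L (D.τ u)).k - (w u).2.2 ≤ 2 * c ∧
        ((w u).1 : ℕ) + (w u).2.1 + (w u).2.2 = 2 * c ∧
        ((D.L (D.τ u)).i - (w u).1) + ((D.L (D.τ u)).j - (w u).2.1) + ((D.L (D.τ u)).k - (w u).2.2) = 2 * c := by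
    intro w hw u
    obtain ⟨u₀, hτ, he⟩ := hocc hw u
    have e1 : T₀.1 (Fin.castAdd n u₀) = (w u).1 := congrArg Prod.fst he
    have e2 : T₀.2.1 (Fin.castAdd n u₀) = (w u).2.1 := congrArg (fun x => x.2.1) he
    have e3 : T₀.2.2 (Fin.castAdd n u₀) = (w u).2.2 := congrArg (fun x => x.2.2) he
    have a1 := hI₀ u₀; have a2 := hJ₀ u₀; have a3 := hK₀ u₀
    have l1 := hlev₀ (Fin.castAdd n u₀); have l2 := hlev₀ (Fin.natAdd n u₀)
    simp only [seqVal] at l1 l2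
    have b1 := (T₀.1 (Fin.natAdd n u₀)).isLt; have b2 := (T₀.2.1 (Fin.natAdd n u₀)).isLt; have b3 := (T₀.2.2 (Fin.natAdd n u₀)).isLt
    rw [hτ] at a1 a2 a3
    rw [← e1, ← e2, ← e3]
    omega
  -- values of `ofLeftWord`
  have hvalL : ∀ (w : Fin n → Fin (2 * c + 1) × Fin (2 * c + 1) × Fin (2 * c + 1)) (u : Fin n),
      (D.ofLeftWord w).1 (Fin.castAdd n u) = (w u).1 ∧ (D.ofLeftWord w).2.1 (Fin.castAdd n u) = (w u).2.1 ∧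
        (D.ofLeftWord w).2.2 (Fin.castAdd n u) = (w u).2.2 := by
    intro w u; exact ⟨by simp [ofLeftWord], by simp [ofLeftWord], by simp [ofLeftWord]⟩
  have hvalR : ∀ {w : Fin n → Fin (2 * c + 1) × Fin (2 * c + 1) × Fin (2 * c + 1)}, w ∈ multiTypeClass D.τ D.leftCounts → ∀ u : Fin n,
      ((D.ofLeftWord w).1 (Fin.natAdd n u) : ℕ) = (D.L (D.τ u)).i - (w u).1 ∧
        ((D.ofLeftWord w).2.1 (Fin.natAdd n u) : ℕ) = (D.L (D.τ u)).j - (w u).2.1 ∧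
          ((D.ofLeftWord w).2.2 (Fin.natAdd n u) : ℕ) = (D.L (D.τ u)).k - (w u).2.2 := by
    intro w hw u
    obtain ⟨-, -, -, h4, h5, h6, -⟩ := hgood hw u
    simp only [ofLeftWord, Fin.addCases_right]
    exact ⟨val_finSub_of_le h4, val_finSub_of_le h5, val_finSub_of_le h6⟩
  have hinside : ∀ {w : Fin n → Fin (2 * c + 1) × Fin (2 * c + 1) × Fin (2 * c + 1)}, w ∈ multiTypeClass D.τ D.leftCounts →
      InsideX D.τ D.L (D.ofLeftWord w).1 ∧ InsideY D.τ D.L (D.ofLeftWord w).2.1 ∧ InsideZ D.τ D.L (D.ofLeftWord w).2.2 := by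
    intro w hw
    refine ⟨fun u => ?_, fun u => ?_, fun u => ?_⟩
    · obtain ⟨h1, -, -⟩ := hgood hw u
      rw [(hvalL w u).1, (hvalR hw u).1]; omega
    · obtain ⟨-, h2, -⟩ := hgood hw u
      rw [(hvalL w u).2.1, (hvalR hw u).2.1]; omega
    · obtain ⟨-, -, h3, -⟩ := hgood hw u
      rw [(hvalL w u).2.2, (hvalR hw u).2.2]; omega
  -- left counts of the triple of `w` are those of `T₀`
  have hleft : ∀ {w : Fin n → Fin (2 * c + 1) × Fin (2 * c + 1) × Fin (2 * c + 1)}, w ∈ multiTypeClass D.τ D.leftCounts →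
      ∀ t a, countOn (classOf D.τ t) (leftWord (D.ofLeftWord w)) a = countOn (classOf D.τ t) (leftWord T₀) a := by
    intro w hw t a
    rw [leftWord_ofLeftWord, (mem_multiTypeClass.1 hw) t a, (mem_multiTypeClass.1 hw₀) t a]
  -- the triple of `w` lies in the universe and is consistent
  have hmemU : ∀ {w : Fin n → Fin (2 * c + 1) × Fin (2 * c + 1) × Fin (2 * c + 1)}, w ∈ multiTypeClass D.τ D.leftCounts →
      D.ofLeftWord w ∈ D.tripleSet := by
    intro w hw
    obtain ⟨hIw, hJw, hKw⟩ := hinside hw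
    rw [mem_tripleUniverse]
    refine ⟨⟨?_, ?_, ?_⟩, fun p => ?_⟩
    · rw [mem_pairTypeClass, mem_multiTypeClass]
      intro t lr
      obtain ⟨l, r⟩ := lr
      rw [← (mem_multiTypeClass.1 ((mem_pairTypeClass D.τ).1 hX₀)) t (l, r), countOn_halfPairs_of_inside hIw,
        countOn_halfPairs_of_inside hI₀, card_filter_left_eq_sum, card_filter_left_eq_sum]
      simp only [hleft hw]
    · rw [mem_pairTypeClass, mem_multiTypeClass]
      intro t lr
      obtain ⟨l, r⟩ := lr
      have hJw' : InsideX D.τ (fun t => (D.L t).swapXY) (D.ofLeftWord w).2.1 := fun u => by simpa using hJw u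
      have hJ₀' : InsideX D.τ (fun t => (D.L t).swapXY) T₀.2.1 := fun u => by simpa using hJ₀ u
      rw [← (mem_multiTypeClass.1 ((mem_pairTypeClass D.τ).1 hY₀)) t (l, r),
        countOn_halfPairs_of_inside (D := { D with L := fun t => (D.L t).swapXY }) hJw',
        countOn_halfPairs_of_inside (D := { D with L := fun t => (D.L t).swapXY }) hJ₀']
      show (if (r : ℕ) = (D.L t).swapXY.i - l then ((classOf D.τ t).filter fun u => (D.ofLeftWord w).2.1 (Fin.castAdd n u) = l).card else 0) =
        if (r : ℕ) = (D.L t).swapXY.i - l then ((classOf D.τ t).filter fun u => T₀.2.1 (Fin.castAdd n u) = l).card else 0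
      rw [card_filter_left_eq_sum₂, card_filter_left_eq_sum₂]
      simp only [hleft hw]
    · rw [mem_pairTypeClass, mem_multiTypeClass]
      intro t lr
      obtain ⟨l, r⟩ := lr
      have hKw' : InsideX D.τ (fun t => (D.L t).swapXZ) (D.ofLeftWord w).2.2 := fun u => by simpa using hKw u
      have hK₀' : InsideX D.τ (fun t => (D.L t).swapXZ) T₀.2.2 := fun u => by simpa using hK₀ u
      rw [← (mem_multiTypeClass.1 ((mem_pairTypeClass D.τ).1 hZ₀)) t (l, r),
        countOn_halfPairs_of_inside (D := { D with L := fun t => (D.L t).swapXZ }) hKw',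
        countOn_halfPairs_of_inside (D := { D with L := fun t => (D.L t).swapXZ }) hK₀']
      show (if (r : ℕ) = (D.L t).swapXZ.i - l then ((classOf D.τ t).filter fun u => (D.ofLeftWord w).2.2 (Fin.castAdd n u) = l).card else 0) =
        if (r : ℕ) = (D.L t).swapXZ.i - l then ((classOf D.τ t).filter fun u => T₀.2.2 (Fin.castAdd n u) = l).card else 0
      rw [card_filter_left_eq_sum₃, card_filter_left_eq_sum₃]
      simp only [hleft hw]
    · refine Fin.addCases (motive := fun p => ((D.ofLeftWord w).1 p : ℕ) + (D.ofLeftWord w).2.1 p + (D.ofLeftWord w).2.2 p = 2 * c)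
        (fun u => ?_) (fun u => ?_) p
      · rw [(hvalL w u).1, (hvalL w u).2.1, (hvalL w u).2.2]
        exact (hgood hw u).2.2.2.2.2.2.1
      · rw [(hvalR hw u).1, (hvalR hw u).2.1, (hvalR hw u).2.2]
        exact (hgood hw u).2.2.2.2.2.2.2
  have hmemC : ∀ {w : Fin n → Fin (2 * c + 1) × Fin (2 * c + 1) × Fin (2 * c + 1)}, w ∈ multiTypeClass D.τ D.leftCounts →
      D.ofLeftWord w ∈ D.consistent := by
    intro w hw
    refine mem_filter.2 ⟨hmemU hw, fun t ijk => ?_⟩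
    by_cases hsmall : ijk.1 ≤ 2 * c ∧ ijk.2.1 ≤ 2 * c ∧ ijk.2.2 ≤ 2 * c
    · have e := card_leftClass_eq_countOn (D := D) (D.ofLeftWord w) t (⟨ijk.1, by omega⟩, ⟨ijk.2.1, by omega⟩, ⟨ijk.2.2, by omega⟩)
      have e₀ := card_leftClass_eq_countOn (D := D) T₀ t (⟨ijk.1, by omega⟩, ⟨ijk.2.1, by omega⟩, ⟨ijk.2.2, by omega⟩)
      simp only at e e₀
      rw [e, hleft hw, ← e₀]
      exact hcnt₀ t ijk
    · -- out of range: both classes are empty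
      have hempty : ∀ (T : (Fin (n + n) → Fin (2 * c + 1)) × (Fin (n + n) → Fin (2 * c + 1)) × (Fin (n + n) → Fin (2 * c + 1))),
          leftClass D.τ (seqVal T.1) (seqVal T.2.1) (seqVal T.2.2) t ijk.1 ijk.2.1 ijk.2.2 = ∅ := by
        intro T
        rw [Finset.eq_empty_iff_forall_notMem]
        intro u hu
        rw [mem_leftClass] at hu
        obtain ⟨-, h1, h2, h3⟩ := hu
        simp only [seqVal] at h1 h2 h3
        have := (T.1 (Fin.castAdd n u)).isLt
        have := (T.2.1 (Fin.castAdd n u)).isLt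
        have := (T.2.2 (Fin.castAdd n u)).isLt
        omega
      rw [hempty, ← hempty T₀]
      exact hcnt₀ t ijk
  -- the bijection
  symm
  refine card_nbij' D.ofLeftWord leftWord (fun w hw => mem_coe.2 (hmemC (mem_coe.1 hw)))
    (fun T hT => mem_coe.2 (leftWord_mem_of_consistent (mem_coe.1 hT))) (fun w _ => leftWord_ofLeftWord w) (fun T hT => ?_)
  obtain ⟨hTu, -⟩ := mem_filter.1 (mem_coe.1 hT)
  obtain ⟨-, hI, hJ, hK⟩ := tripleSet_good hD hTu
  exact ofLeftWord_leftWord hI hJ hK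

/-- **`numalpha ≤ 2^{∑_t n_t · H(cnt t / n_t)}`** (= `2^{∑_t H(α_t) A_{t,1} n_t}`; Lemma 3.3).
[cite: VassilevskaWilliamsXuXuZhou2024, §6.2 (numalpha)] -/
theorem card_consistent_le_two_rpow (hD : D.WellFormed)
    {T₀ : (Fin (n + n) → Fin (2 * c + 1)) × (Fin (n + n) → Fin (2 * c + 1)) × (Fin (n + n) → Fin (2 * c + 1))} (hT₀ : T₀ ∈ D.consistent) :
    (D.consistent.card : ℝ) ≤ 2 ^ (∑ t, (Fintype.card {u // D.τ u = t} : ℝ) *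
      shannonEntropy fun a => (D.leftCounts t a : ℝ) / Fintype.card {u // D.τ u = t}) := by
  rw [card_consistent_eq hD hT₀]
  exact card_multiTypeClass_le_two_rpow D.τ _ fun t => sum_eq_card_of_mem_multiTypeClass (leftWord_mem_of_consistent hT₀) t

/-- **`2^{∑_t n_t · H(cnt t / n_t)} ≤ (∏_t (n_t+1)^{(2c+1)³}) · numalpha`** (Lemma 3.3). [cite: VassilevskaWilliamsXuXuZhou2024, §6.2 (numalpha)] -/
theorem two_rpow_le_mul_card_consistent (hD : D.WellFormed)
    {T₀ : (Fin (n + n) → Fin (2 * c + 1)) × (Fin (n + n) → Fin (2 * c + 1)) × (Fin (n + n) → Fin (2 * c + 1))} (hT₀ : T₀ ∈ D.consistent) :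
    (2 : ℝ) ^ (∑ t, (Fintype.card {u // D.τ u = t} : ℝ) * shannonEntropy fun a => (D.leftCounts t a : ℝ) / Fintype.card {u // D.τ u = t}) ≤
      (∏ t, ((Fintype.card {u // D.τ u = t} : ℝ) + 1) ^ Fintype.card (Fin (2 * c + 1) × Fin (2 * c + 1) × Fin (2 * c + 1))) *
        D.consistent.card := by
  rw [card_consistent_eq hD hT₀]
  exact two_rpow_le_mul_card_multiTypeClass D.τ _ fun t => sum_eq_card_of_mem_multiTypeClass (leftWord_mem_of_consistent hT₀) t

/-! ## `M_Z` and the level-1 block counts of `𝒯*` -/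

/-- **`M_Z(T) = |levelBlocksZ(𝒯*_T)|`.** [cite: VassilevskaWilliamsXuXuZhou2024, §6.5 (𝒯*) and Cor. 4.2 (M_Z)] -/
theorem usefulZCount_eq_card_levelBlocksZ
    {T : (Fin (n + n) → Fin (2 * c + 1)) × (Fin (n + n) → Fin (2 * c + 1)) × (Fin (n + n) → Fin (2 * c + 1))}
    (h : IsLevelTriple c (seqVal T.1) (seqVal T.2.1) (seqVal T.2.2)) :
    D.usefulZCount T = (levelBlocksZ (pairTermIdx D.τ h) (pairTermList c s D.βX D.βY D.βZ) 0).card := by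
  unfold usefulZCount
  congr 1
  ext Kh
  rw [mem_filter, mem_levelBlocksZ_pair_iff D.τ h, chunkLevels_eq_iff, toHashed_UZ]
  simp

/-- **`M_Z(T) ≥ 2^{∑_{(t,(i',j',k'))} |S_{t,i',j',k'}| H(β_{Z,t,i',j',k'})} / ∏ (|S|+1)^{3^c}`** for integral class
types `k = |S| · β_Z` supported on level `k'` (Lemma 3.3 per class; "the number of possibilities of K̂ on
the subset of indices S_{t,i',j',k'} is 2^{H(β_{Z,t,i',j',k'}) |S_{t,i',j',k'}| ± o(n)}").
[cite: VassilevskaWilliamsXuXuZhou2024, Claim 6.13 (proof) and Cor. 4.2] -/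
theorem two_rpow_le_mul_usefulZCount
    {T : (Fin (n + n) → Fin (2 * c + 1)) × (Fin (n + n) → Fin (2 * c + 1)) × (Fin (n + n) → Fin (2 * c + 1))}
    (h : IsLevelTriple c (seqVal T.1) (seqVal T.2.1) (seqVal T.2.2)) (k : Fin (s * (constituentTriples c).card) → (Fin c → Fin 3) → ℕ)
    (hk : ∀ idx σ, (k idx σ : ℝ) = (termFibre (pairTermIdx D.τ h) idx).card * (pairTermList c s D.βX D.βY D.βZ idx).γZ σ)
    (hsupp : ∀ idx σ, k idx σ ≠ 0 → patternLevel σ = (pairTermList c s D.βX D.βY D.βZ idx).k)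
    (hsum : ∀ idx, ∑ σ, k idx σ = (termFibre (pairTermIdx D.τ h) idx).card) :
    (2 : ℝ) ^ (∑ idx, ((termFibre (pairTermIdx D.τ h) idx).card : ℝ) *
        shannonEntropy (fun σ => (k idx σ : ℝ) / (termFibre (pairTermIdx D.τ h) idx).card)) ≤
      (∏ idx, (((termFibre (pairTermIdx D.τ h) idx).card + 1 : ℝ)) ^ (3 ^ c)) * D.usefulZCount T := by
  rw [usefulZCount_eq_card_levelBlocksZ h, levelBlocksZ_eq_levelBlocksX_swapXZ]
  exact two_rpow_le_mul_card_levelBlocksX_zero _ _ k (fun idx σ => by simpa using hk idx σ) (fun idx σ => by simpa using hsupp idx σ) hsum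

/-- **The level-1 `Z`-block count of `𝒯*` from below** (the same statement for `levelBlocksZ`, used as the
hole budget of Cor. 4.2). [cite: VassilevskaWilliamsXuXuZhou2024, Cor. 4.2 (M_Z)] -/
theorem two_rpow_le_mul_card_levelBlocksZ_star {I J K : Fin (n + n) → ℕ} (h : IsLevelTriple c I J K)
    (k : Fin (s * (constituentTriples c).card) → (Fin c → Fin 3) → ℕ)
    (hk : ∀ idx σ, (k idx σ : ℝ) = (termFibre (pairTermIdx D.τ h) idx).card * (pairTermList c s D.βX D.βY D.βZ idx).γZ σ)
    (hsupp : ∀ idx σ, k idx σ ≠ 0 → patternLevel σ = (pairTermList c s D.βX D.βY D.βZ idx).k)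
    (hsum : ∀ idx, ∑ σ, k idx σ = (termFibre (pairTermIdx D.τ h) idx).card) :
    (2 : ℝ) ^ (∑ idx, ((termFibre (pairTermIdx D.τ h) idx).card : ℝ) *
        shannonEntropy (fun σ => (k idx σ : ℝ) / (termFibre (pairTermIdx D.τ h) idx).card)) ≤
      (∏ idx, (((termFibre (pairTermIdx D.τ h) idx).card + 1 : ℝ)) ^ (3 ^ c)) *
        (levelBlocksZ (pairTermIdx D.τ h) (pairTermList c s D.βX D.βY D.βZ) 0).card := by
  rw [levelBlocksZ_eq_levelBlocksX_swapXZ]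
  exact two_rpow_le_mul_card_levelBlocksX_zero _ _ k (fun idx σ => by simpa using hk idx σ) (fun idx σ => by simpa using hsupp idx σ) hsum

/-- **The level-1 `X`-block count of `𝒯*` from below** (`M_X`). [cite: VassilevskaWilliamsXuXuZhou2024, Cor. 4.2 (M_X)] -/
theorem two_rpow_le_mul_card_levelBlocksX_star {I J K : Fin (n + n) → ℕ} (h : IsLevelTriple c I J K)
    (k : Fin (s * (constituentTriples c).card) → (Fin c → Fin 3) → ℕ)
    (hk : ∀ idx σ, (k idx σ : ℝ) = (termFibre (pairTermIdx D.τ h) idx).card * (pairTermList c s D.βX D.βY D.βZ idx).γX σ)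
    (hsupp : ∀ idx σ, k idx σ ≠ 0 → patternLevel σ = (pairTermList c s D.βX D.βY D.βZ idx).i)
    (hsum : ∀ idx, ∑ σ, k idx σ = (termFibre (pairTermIdx D.τ h) idx).card) :
    (2 : ℝ) ^ (∑ idx, ((termFibre (pairTermIdx D.τ h) idx).card : ℝ) *
        shannonEntropy (fun σ => (k idx σ : ℝ) / (termFibre (pairTermIdx D.τ h) idx).card)) ≤
      (∏ idx, (((termFibre (pairTermIdx D.τ h) idx).card + 1 : ℝ)) ^ (3 ^ c)) *
        (levelBlocksX (pairTermIdx D.τ h) (pairTermList c s D.βX D.βY D.βZ) 0).card :=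
  two_rpow_le_mul_card_levelBlocksX_zero _ _ k hk hsupp hsum

/-- **The level-1 `Y`-block count of `𝒯*` from below** (`M_Y`). [cite: VassilevskaWilliamsXuXuZhou2024, Cor. 4.2 (M_Y)] -/
theorem two_rpow_le_mul_card_levelBlocksY_star {I J K : Fin (n + n) → ℕ} (h : IsLevelTriple c I J K)
    (k : Fin (s * (constituentTriples c).card) → (Fin c → Fin 3) → ℕ)
    (hk : ∀ idx σ, (k idx σ : ℝ) = (termFibre (pairTermIdx D.τ h) idx).card * (pairTermList c s D.βX D.βY D.βZ idx).γY σ)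
    (hsupp : ∀ idx σ, k idx σ ≠ 0 → patternLevel σ = (pairTermList c s D.βX D.βY D.βZ idx).j)
    (hsum : ∀ idx, ∑ σ, k idx σ = (termFibre (pairTermIdx D.τ h) idx).card) :
    (2 : ℝ) ^ (∑ idx, ((termFibre (pairTermIdx D.τ h) idx).card : ℝ) *
        shannonEntropy (fun σ => (k idx σ : ℝ) / (termFibre (pairTermIdx D.τ h) idx).card)) ≤
      (∏ idx, (((termFibre (pairTermIdx D.τ h) idx).card + 1 : ℝ)) ^ (3 ^ c)) *
        (levelBlocksY (pairTermIdx D.τ h) (pairTermList c s D.βX D.βY D.βZ) 0).card := by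
  rw [levelBlocksY_eq_levelBlocksX_swapXY]
  exact two_rpow_le_mul_card_levelBlocksX_zero _ _ k (fun idx σ => by simpa using hk idx σ) (fun idx σ => by simpa using hsupp idx σ) hsum

/-! ## `numtriple` and the penalty `P_{α,t}`: Claim 6.5, upper bound -/

/-- **The support of the left split types of term `t`**: constituent triples `(i',j',k') ≤ (i_t,j_t,k_t)`
whose complements are constituent. [cite: VassilevskaWilliamsXuXuZhou2024, Claim 6.5 (D_t) and §6 (preamble)] -/
def leftSupport (c : ℕ) (T : InterfaceTerm (c + c)) : Finset (Fin (2 * c + 1) × Fin (2 * c + 1) × Fin (2 * c + 1)) :=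
  univ.filter fun a => (a.1 : ℕ) + a.2.1 + a.2.2 = 2 * c ∧ (a.1 : ℕ) ≤ T.i ∧ (a.2.1 : ℕ) ≤ T.j ∧ (a.2.2 : ℕ) ≤ T.k ∧
    (T.i - a.1) + (T.j - a.2.1) + (T.k - a.2.2) = 2 * c

/-- Sums over the triples with a fixed first coordinate. [folklore] -/
theorem sum_filter_fst_eq {α β γ R' : Type*} [AddCommMonoid R'] [Fintype α] [DecidableEq α] [Fintype β] [Fintype γ] (f : α × β × γ → R') (i : α) :
    ∑ a ∈ univ.filter (fun a : α × β × γ => a.1 = i), f a = ∑ b, ∑ d, f (i, b, d) := by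
  rw [← Finset.sum_product']
  refine Finset.sum_nbij' (fun a => (a.2.1, a.2.2)) (fun bd => (i, bd.1, bd.2)) (fun a _ => by simp) (fun bd _ => by simp)
    (fun a ha => ?_) (fun bd _ => rfl) (fun a ha => ?_)
  · have h := (mem_filter.1 ha).2
    rcases a with ⟨a1, a2, a3⟩; simp only at h; subst h; rfl
  · have h := (mem_filter.1 ha).2
    rcases a with ⟨a1, a2, a3⟩; simp only at h; subst h; rfl

/-- Sums over the triples with a fixed second coordinate. [folklore] -/
theorem sum_filter_snd_eq {α β γ R' : Type*} [AddCommMonoid R'] [Fintype α] [Fintype β] [DecidableEq β] [Fintype γ] (f : α × β × γ → R') (j : β) :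
    ∑ a ∈ univ.filter (fun a : α × β × γ => a.2.1 = j), f a = ∑ i, ∑ d, f (i, j, d) := by
  rw [← Finset.sum_product']
  refine Finset.sum_nbij' (fun a => (a.1, a.2.2)) (fun id => (id.1, j, id.2)) (fun a _ => by simp) (fun id _ => by simp)
    (fun a ha => ?_) (fun id _ => rfl) (fun a ha => ?_)
  · have h := (mem_filter.1 ha).2
    rcases a with ⟨a1, a2, a3⟩; simp only at h; subst h; rfl
  · have h := (mem_filter.1 ha).2
    rcases a with ⟨a1, a2, a3⟩; simp only at h; subst h; rfl

/-- Sums over the triples with a fixed third coordinate. [folklore] -/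
theorem sum_filter_thd_eq {α β γ R' : Type*} [AddCommMonoid R'] [Fintype α] [Fintype β] [Fintype γ] [DecidableEq γ] (f : α × β × γ → R') (k : γ) :
    ∑ a ∈ univ.filter (fun a : α × β × γ => a.2.2 = k), f a = ∑ i, ∑ j, f (i, j, k) := by
  rw [← Finset.sum_product']
  refine Finset.sum_nbij' (fun a => (a.1, a.2.1)) (fun ij => (ij.1, ij.2, k)) (fun a _ => by simp) (fun ij _ => by simp)
    (fun a ha => ?_) (fun ij _ => rfl) (fun a ha => ?_)
  · have h := (mem_filter.1 ha).2
    rcases a with ⟨a1, a2, a3⟩; simp only at h; subst h; rfl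
  · have h := (mem_filter.1 ha).2
    rcases a with ⟨a1, a2, a3⟩; simp only at h; subst h; rfl

/-- **The left marginal counts of a remaining block are read off its pair counts**:
`#{u ∈ term t | I(left u) = i} = ∑_r k_X t (i, r)`. [cite: VassilevskaWilliamsXuXuZhou2024, §6.2] -/
theorem card_filter_left_eq_sum_pairCounts {kX : Fin s → Fin (2 * c + 1) × Fin (2 * c + 1) → ℕ} {I : Fin (n + n) → Fin (2 * c + 1)}
    (hI : I ∈ pairTypeClass D.τ kX) (t : Fin s) (i : Fin (2 * c + 1)) :
    ((classOf D.τ t).filter fun u => I (Fin.castAdd n u) = i).card = ∑ r, kX t (i, r) := by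
  have h := countOn_comp_eq_sum (classOf D.τ t) (halfPairs I) Prod.fst i
  have e : ((classOf D.τ t).filter fun u => I (Fin.castAdd n u) = i) = (classOf D.τ t).filter fun u => (Prod.fst ∘ halfPairs I) u = i := by
    rfl
  rw [e, ← countOn_apply, h]
  have hk := mem_multiTypeClass.1 ((mem_pairTypeClass D.τ).1 hI) t
  rw [sum_congr rfl (fun a _ => hk a)]
  refine Finset.sum_nbij' (fun a => a.2) (fun r => (i, r)) (fun a _ => mem_univ _) (fun r _ => by simp) (fun a ha => ?_)
    (fun r _ => rfl) (fun a ha => ?_)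
  · obtain ⟨a1, a2⟩ := a
    have h1 : a1 = i := (mem_filter.1 ha).2
    subst h1; rfl
  · obtain ⟨a1, a2⟩ := a
    have h1 : a1 = i := (mem_filter.1 ha).2
    subst h1; rfl

/-- Left `I`-counts as double sums of left-word counts. [folklore] -/
theorem sum_sum_countOn_leftWord_fst (T : (Fin (n + n) → Fin (2 * c + 1)) × (Fin (n + n) → Fin (2 * c + 1)) × (Fin (n + n) → Fin (2 * c + 1)))
    (t : Fin s) (i : Fin (2 * c + 1)) :
    ∑ j, ∑ k, countOn (classOf D.τ t) (leftWord T) (i, j, k) = ((classOf D.τ t).filter fun u => T.1 (Fin.castAdd n u) = i).card := by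
  rw [card_filter_left_eq_sum]; exact (sum_filter_fst_eq _ i).symm

/-- Left `J`-counts as double sums of left-word counts. [folklore] -/
theorem sum_sum_countOn_leftWord_snd (T : (Fin (n + n) → Fin (2 * c + 1)) × (Fin (n + n) → Fin (2 * c + 1)) × (Fin (n + n) → Fin (2 * c + 1)))
    (t : Fin s) (j : Fin (2 * c + 1)) :
    ∑ i, ∑ k, countOn (classOf D.τ t) (leftWord T) (i, j, k) = ((classOf D.τ t).filter fun u => T.2.1 (Fin.castAdd n u) = j).card := by
  rw [card_filter_left_eq_sum₂]; exact (sum_filter_snd_eq _ j).symm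

/-- Left `K`-counts as double sums of left-word counts. [folklore] -/
theorem sum_sum_countOn_leftWord_thd (T : (Fin (n + n) → Fin (2 * c + 1)) × (Fin (n + n) → Fin (2 * c + 1)) × (Fin (n + n) → Fin (2 * c + 1)))
    (t : Fin s) (k : Fin (2 * c + 1)) :
    ∑ i, ∑ j, countOn (classOf D.τ t) (leftWord T) (i, j, k) = ((classOf D.τ t).filter fun u => T.2.2 (Fin.castAdd n u) = k).card := by
  rw [card_filter_left_eq_sum₃]; exact (sum_filter_thd_eq _ k).symm

/-- **Claim 6.5, upper bound: `numtriple ≤ (n+1)^{s (2c+1)³} · 2^{∑_t n_t · max_{α' ∈ D_t} H(α')}`** — a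
remaining triple is determined by its left word, whose split-type distribution on each term shares the
marginals of `α_t` (they are read off the pair counts `k_X, k_Y, k_Z`), so lies in a multi-class type
class of entropy at most `∑_t n_t max_{D_t} H` (Lemma 3.3); there are at most `(n+1)^{s(2c+1)³}` classes.
[cite: VassilevskaWilliamsXuXuZhou2024, Claim 6.5] -/
theorem card_tripleSet_le_two_rpow (hD : D.WellFormed)
    {T₀ : (Fin (n + n) → Fin (2 * c + 1)) × (Fin (n + n) → Fin (2 * c + 1)) × (Fin (n + n) → Fin (2 * c + 1))} (hT₀ : T₀ ∈ D.consistent) :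
    (D.tripleSet.card : ℝ) ≤ ((n : ℝ) + 1) ^ (s * Fintype.card (Fin (2 * c + 1) × Fin (2 * c + 1) × Fin (2 * c + 1))) *
      2 ^ (∑ t, (Fintype.card {u // D.τ u = t} : ℝ) *
        maxEntropyGivenMarginals (leftSupport c (D.L t)) (fun a => (D.leftCounts t a : ℝ) / Fintype.card {u // D.τ u = t})) := by
  obtain ⟨hT₀u, hcnt₀⟩ := mem_filter.1 hT₀
  obtain ⟨⟨hX₀, hY₀, hZ₀⟩, -⟩ := mem_tripleUniverse.1 hT₀u
  -- the distribution of the left word of a triple on term `t`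
  set α : Fin s → (Fin (2 * c + 1) × Fin (2 * c + 1) × Fin (2 * c + 1)) → ℝ := fun t a => (D.leftCounts t a : ℝ) / Fintype.card {u // D.τ u = t} with hα
  set E : ℝ := ∑ t, (Fintype.card {u // D.τ u = t} : ℝ) * maxEntropyGivenMarginals (leftSupport c (D.L t)) (α t) with hE
  have hα₀ : ∀ t a, α t a = (countOn (classOf D.τ t) (leftWord T₀) a : ℝ) / Fintype.card {u // D.τ u = t} := by
    intro t a; rw [hα, ← card_leftClass_eq_countOn]; simp only [leftCounts]; rw [hcnt₀ t (a.1, a.2.1, a.2.2)]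
  -- the marginals of the left word distribution of ANY remaining triple are those of `α t`
  have hmarg : ∀ {T : (Fin (n + n) → Fin (2 * c + 1)) × (Fin (n + n) → Fin (2 * c + 1)) × (Fin (n + n) → Fin (2 * c + 1))},
      T ∈ D.tripleSet → ∀ t, 0 < Fintype.card {u // D.τ u = t} →
        (fun a => (countOn (classOf D.τ t) (leftWord T) a : ℝ) / Fintype.card {u // D.τ u = t}) ∈
          sameMarginalsOn (leftSupport c (D.L t)) (α t) := by
    intro T hT t ht
    obtain ⟨⟨hX, hY, hZ⟩, hlevT⟩ := mem_tripleUniverse.1 hT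
    obtain ⟨hlev, hI, hJ, hK⟩ := tripleSet_good hD hT
    have hntR : (0 : ℝ) < Fintype.card {u // D.τ u = t} := by exact_mod_cast ht
    refine ⟨⟨fun a => by positivity, ?_⟩, fun a ha => ?_, ?_, ?_, ?_⟩
    · rw [← Finset.sum_div, div_eq_one_iff_eq hntR.ne']
      rw [card_subtype_classOf]; exact_mod_cast sum_countOn (classOf D.τ t) (leftWord T)
    · -- letters off the support do not occur
      rw [div_eq_zero_iff]; left
      rw [Nat.cast_eq_zero, countOn_apply, Finset.card_eq_zero, Finset.filter_eq_empty_iff]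
      intro u hu heq
      apply ha
      rw [mem_classOf] at hu
      rw [leftSupport, mem_filter]
      refine ⟨mem_univ _, ?_⟩
      have e1 : T.1 (Fin.castAdd n u) = a.1 := congrArg Prod.fst heq
      have e2 : T.2.1 (Fin.castAdd n u) = a.2.1 := congrArg (fun x => x.2.1) heq
      have e3 : T.2.2 (Fin.castAdd n u) = a.2.2 := congrArg (fun x => x.2.2) heq
      have a1 := hI u; have a2 := hJ u; have a3 := hK u
      have l1 := hlev (Fin.castAdd n u); have l2 := hlev (Fin.natAdd n u)
      simp only [seqVal] at l1 l2
      rw [hu] at a1 a2 a3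
      rw [← e1, ← e2, ← e3]
      omega
    · have hαt : α t = fun a => (countOn (classOf D.τ t) (leftWord T₀) a : ℝ) / Fintype.card {u // D.τ u = t} := funext (hα₀ t)
      rw [hαt]
      funext i
      simp only [marginalDist₁, ← Finset.sum_div]
      congr 1
      have e := sum_sum_countOn_leftWord_fst (D := D) T t i
      have e₀ := sum_sum_countOn_leftWord_fst (D := D) T₀ t i
      rw [card_filter_left_eq_sum_pairCounts hX] at e
      rw [card_filter_left_eq_sum_pairCounts hX₀] at e₀
      exact_mod_cast e.trans e₀.symm
    · have hαt : α t = fun a => (countOn (classOf D.τ t) (leftWord T₀) a : ℝ) / Fintype.card {u // D.τ u = t} := funext (hα₀ t)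
      rw [hαt]
      funext j
      simp only [marginalDist₂, ← Finset.sum_div]
      congr 1
      have hY' : T.2.1 ∈ pairTypeClass D.τ D.kY := hY
      have e := sum_sum_countOn_leftWord_snd (D := D) T t j
      have e₀ := sum_sum_countOn_leftWord_snd (D := D) T₀ t j
      rw [card_filter_left_eq_sum_pairCounts (D := D) (I := T.2.1) hY'] at e
      rw [card_filter_left_eq_sum_pairCounts (D := D) (I := T₀.2.1) hY₀] at e₀
      exact_mod_cast e.trans e₀.symm
    · have hαt : α t = fun a => (countOn (classOf D.τ t) (leftWord T₀) a : ℝ) / Fintype.card {u // D.τ u = t} := funext (hα₀ t)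
      rw [hαt]
      funext k
      simp only [marginalDist₃, ← Finset.sum_div]
      congr 1
      have hZ' : T.2.2 ∈ pairTypeClass D.τ D.kZ := hZ
      have e := sum_sum_countOn_leftWord_thd (D := D) T t k
      have e₀ := sum_sum_countOn_leftWord_thd (D := D) T₀ t k
      rw [card_filter_left_eq_sum_pairCounts (D := D) (I := T.2.2) hZ'] at e
      rw [card_filter_left_eq_sum_pairCounts (D := D) (I := T₀.2.2) hZ₀] at e₀
      exact_mod_cast e.trans e₀.symm
  -- the good words and their count functions
  set cnts : (Fin n → (Fin (2 * c + 1) × Fin (2 * c + 1) × Fin (2 * c + 1))) → Fin s → (Fin (2 * c + 1) × Fin (2 * c + 1) × Fin (2 * c + 1)) → ℕ := fun w t a => countOn (classOf D.τ t) w a with hcnts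
  set Wgood := (univ : Finset (Fin n → (Fin (2 * c + 1) × Fin (2 * c + 1) × Fin (2 * c + 1)))).filter fun w => ∀ t, 0 < Fintype.card {u // D.τ u = t} →
    (fun a => (cnts w t a : ℝ) / Fintype.card {u // D.τ u = t}) ∈ sameMarginalsOn (leftSupport c (D.L t)) (α t) with hWgood
  -- (1) the universe injects into the good words
  have h1 : D.tripleSet.card ≤ Wgood.card := by
    refine card_le_card_of_injOn leftWord (fun T hT => ?_) (fun T₁ h₁ T₂ h₂ heq => ?_)
    · exact mem_coe.2 (mem_filter.2 ⟨mem_univ _, fun t ht => hmarg (mem_coe.1 hT) t ht⟩)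
    · obtain ⟨-, hI₁, hJ₁, hK₁⟩ := tripleSet_good hD (mem_coe.1 h₁)
      obtain ⟨-, hI₂, hJ₂, hK₂⟩ := tripleSet_good hD (mem_coe.1 h₂)
      rw [← ofLeftWord_leftWord (D := D) hI₁ hJ₁ hK₁, ← ofLeftWord_leftWord (D := D) hI₂ hJ₂ hK₂]
      exact congrArg D.ofLeftWord heq
  -- (2) each fibre of the count map is a multi-class type class of entropy `≤ E`
  set Kset := Wgood.image cnts with hKset
  have h2 : (Wgood.card : ℝ) ≤ Kset.card * 2 ^ E := by
    rw [card_eq_sum_card_fiberwise (f := cnts) (s := Wgood) (t := Kset) (fun w hw => mem_image_of_mem _ hw)]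
    push_cast
    rw [show (Kset.card : ℝ) * 2 ^ E = ∑ _k ∈ Kset, (2 : ℝ) ^ E by rw [sum_const, nsmul_eq_mul]]
    refine sum_le_sum fun k hk => ?_
    obtain ⟨w, hw, rfl⟩ := mem_image.1 hk
    have hwmem : w ∈ multiTypeClass D.τ (cnts w) := mem_multiTypeClass.2 fun _ _ => rfl
    have hsum : ∀ t, ∑ a, cnts w t a = Fintype.card {u // D.τ u = t} := sum_eq_card_of_mem_multiTypeClass hwmem
    have hsub : (Wgood.filter fun w' => cnts w' = cnts w) ⊆ multiTypeClass D.τ (cnts w) := by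
      intro w' hw'
      have he : cnts w' = cnts w := (mem_filter.1 hw').2
      exact mem_multiTypeClass.2 fun t a => congrFun (congrFun he t) a
    calc (((Wgood.filter fun w' => cnts w' = cnts w)).card : ℝ) ≤ (multiTypeClass D.τ (cnts w)).card := by
          exact_mod_cast card_le_card hsub
      _ ≤ 2 ^ (∑ t, (Fintype.card {u // D.τ u = t} : ℝ) * shannonEntropy fun a => (cnts w t a : ℝ) / Fintype.card {u // D.τ u = t}) :=
          card_multiTypeClass_le_two_rpow D.τ (cnts w) hsum
      _ ≤ 2 ^ E := by
          refine Real.rpow_le_rpow_of_exponent_le one_le_two (sum_le_sum fun t _ => ?_)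
          rcases Nat.eq_zero_or_pos (Fintype.card {u // D.τ u = t}) with ht | ht
          · rw [ht]; simp
          · refine mul_le_mul_of_nonneg_left ?_ (Nat.cast_nonneg _)
            exact shannonEntropy_le_maxEntropyGivenMarginals ((mem_filter.1 hw).2 t ht)
  -- (3) there are at most `(n+1)^{s |A|}` count functions
  have h3 : (Kset.card : ℝ) ≤ ((n : ℝ) + 1) ^ (s * Fintype.card (Fin (2 * c + 1) × Fin (2 * c + 1) × Fin (2 * c + 1))) := by
    have hle : Kset.card ≤ Fintype.card (Fin s → (Fin (2 * c + 1) × Fin (2 * c + 1) × Fin (2 * c + 1)) → Fin (n + 1)) := by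
      refine card_le_card_of_injOn (fun k t a => (⟨min (k t a) n, by omega⟩ : Fin (n + 1))) (fun _ _ => mem_coe.2 (mem_univ _))
        (fun k₁ hk₁ k₂ hk₂ heq => ?_)
      obtain ⟨w₁, -, rfl⟩ := mem_image.1 (mem_coe.1 hk₁)
      obtain ⟨w₂, -, rfl⟩ := mem_image.1 (mem_coe.1 hk₂)
      funext t a
      have h := congrFun (congrFun heq t) a
      simp only [Fin.mk.injEq] at h
      have b₁ : cnts w₁ t a ≤ n := (countOn_le_card _ _ _).trans ((card_le_univ _).trans (by simp))
      have b₂ : cnts w₂ t a ≤ n := (countOn_le_card _ _ _).trans ((card_le_univ _).trans (by simp))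
      rw [min_eq_left b₁, min_eq_left b₂] at h
      exact h
    have : (Kset.card : ℝ) ≤ Fintype.card (Fin s → (Fin (2 * c + 1) × Fin (2 * c + 1) × Fin (2 * c + 1)) → Fin (n + 1)) := by exact_mod_cast hle
    refine this.trans_eq ?_
    rw [Fintype.card_fun, Fintype.card_fun, Fintype.card_fin, Fintype.card_fin]
    push_cast; ring
  calc (D.tripleSet.card : ℝ) ≤ Wgood.card := by exact_mod_cast h1
    _ ≤ Kset.card * 2 ^ E := h2
    _ ≤ ((n : ℝ) + 1) ^ (s * Fintype.card (Fin (2 * c + 1) × Fin (2 * c + 1) × Fin (2 * c + 1))) * 2 ^ E := mul_le_mul_of_nonneg_right h3 (by positivity)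

end ConstituentRegion

end Literature.Computability.AlgebraicComplexity
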